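import Literature.NumberTheory.LFunctions.PrimeDirichletPolynomialMoments
import Literature.NumberTheory.LFunctions.DirichletPolynomialGallagher
import HarnessLib

/-!
# Moments of prime Dirichlet polynomials at well-spaced complex points (Balazard–de Roton 2008, Prop. 13)

Topic `Literature/NumberTheory/LFunctions`. Everything in this file is PROVED (no definitions, no
named facts).

The companion of `PrimeDirichletPolynomialMoments.lean` (points on one vertical line) for points
`s_r` with real parts in a strip `0 ≤ Re s_r ≤ L` and `1`-spaced ordinates in `[−T, T]`, which is
the form of M. Balazard, A. de Roton, arXiv:0810.3587, Prop. 13 (= Maier–Montgomery 2009, Lemma 5)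
used for condition (i) in the proof of their Prop. 20 (with `a(p) p^{−1/2}` as coefficients):
`Literature.NumberTheory.LFunctions.sum_norm_primePoly_pow_le_complex`,
`Σ_r |Σ_{p ∈ S} a(p) p^{−s_r}|^{2k} ≤ 26 T (1 + log T)(1 + 2L log T) · k! (Σ_p |a(p)|²)^k` for `N^k ≤ T`.
Proof: the expansion of `P^k` and the coefficient bound of the line case
(`PrimePolyMoments.primePoly_pow_eq`, `PrimePolyMoments.sum_norm_sq_powCoeff_le`) and the tree's
hybrid discrete mean value theorem `Literature.NumberTheory.LFunctions.Gallagher.discreteMeanValue_complex'`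
(Huxley Ch. 19) with `α = 0`.

## References

* [BalazardDeRoton2008] M. Balazard, A. de Roton, arXiv:0810.3587, Prop. 13. [cite: BalazardDeRoton2008, Prop. 13]
* H. Maier, H. L. Montgomery, Bull. London Math. Soc. 41 (2009), Lemma 5.
* M. N. Huxley, *The Distribution of Prime Numbers*, Ch. 19.
-/

noncomputable section

open Complex Finset Fintype

namespace Literature.NumberTheory.LFunctions

open PrimePolyMoments in
/-- **Balazard–de Roton 2008, Prop. 13 (Maier–Montgomery, Lemma 5), complex points in a strip.**
Let `S` be a finite set of primes `≤ N`, `a : ℕ → ℂ`, `k` with `N^k ≤ T`, `T ≥ 1`, `L > 0`, and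
`𝒮` a finite set of complex points with `0 ≤ Re s ≤ L`, `|Im s| ≤ T`, and ordinates pairwise `≥ 1`
apart. Then `Σ_{s ∈ 𝒮} |Σ_{p ∈ S} a(p) p^{−s}|^{2k} ≤ 26 T (1 + log T)(1 + 2L log T) · k! (Σ_{p∈S} |a(p)|²)^k`.
(For `Re s ≥ α` use the coefficients `a(p) p^{−α}` and the points `s − α`.)
[cite: BalazardDeRoton2008, Prop. 13] -/
theorem sum_norm_primePoly_pow_le_complex (S : Finset ℕ) (hS : ∀ p ∈ S, p.Prime) {N : ℕ} (hN : 1 ≤ N)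
    (hSN : ∀ p ∈ S, p ≤ N) (a : ℕ → ℂ) (k : ℕ) {T L : ℝ} (hT : 1 ≤ T) (hL : 0 < L)
    (hNT : ((N ^ k : ℕ) : ℝ) ≤ T) (𝒮 : Finset ℂ) (hre : ∀ s ∈ 𝒮, 0 ≤ s.re ∧ s.re ≤ L)
    (him : ∀ s ∈ 𝒮, |s.im| ≤ T) (hsep : ∀ s ∈ 𝒮, ∀ s' ∈ 𝒮, s ≠ s' → 1 ≤ |s.im - s'.im|) :
    ∑ s ∈ 𝒮, ‖∑ p ∈ S, a p * (p : ℂ) ^ (-s)‖ ^ (2 * k) ≤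
      26 * T * (1 + Real.log T) * (1 + 2 * L * Real.log T) * (k.factorial * (∑ p ∈ S, ‖a p‖ ^ 2) ^ k) := by
  have hS1 : ∀ p ∈ S, 1 ≤ p := fun p hp ↦ (hS p hp).one_lt.le
  have hNk : 1 ≤ N ^ k := Nat.one_le_pow _ _ hN
  have hpow : ∀ s : ℂ, ‖∑ p ∈ S, a p * (p : ℂ) ^ (-s)‖ ^ (2 * k) =
      ‖∑ n ∈ Finset.Icc 1 (N ^ k), powCoeff S a k n * (n : ℂ) ^ (-s)‖ ^ 2 := by
    intro s
    rw [← primePoly_pow_eq hS1 hSN a, norm_pow, ← pow_mul, mul_comm k 2]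
  simp_rw [hpow]
  have hT0 : 0 < T := by linarith
  have hmvt := Gallagher.discreteMeanValue_complex' (powCoeff S a k) (N ^ k) (α := 0) hT0 one_pos hL 𝒮
    (fun s hs ↦ by simpa using hre s hs) him hsep
  have hcoef := sum_norm_sq_powCoeff_le (k := k) hS hSN a
  -- the weight `n^{-2·0} = 1`
  have hw : ∑ n ∈ Finset.Icc 1 (N ^ k), ‖powCoeff S a k n‖ ^ 2 * (n : ℝ) ^ (-(2 * (0 : ℝ))) =
      ∑ n ∈ Finset.Icc 1 (N ^ k), ‖powCoeff S a k n‖ ^ 2 := by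
    refine Finset.sum_congr rfl fun n _ ↦ ?_
    simp
  rw [hw] at hmvt
  have hNk' : (1 : ℝ) ≤ ((N ^ k : ℕ) : ℝ) := by exact_mod_cast hNk
  have hlogN : Real.log ((N ^ k : ℕ) : ℝ) ≤ Real.log T := Real.log_le_log (by positivity) hNT
  have hlogN0 : 0 ≤ Real.log ((N ^ k : ℕ) : ℝ) := Real.log_nonneg hNk'
  have hlogT : 0 ≤ Real.log T := Real.log_nonneg hT
  have hC0 : 0 ≤ (k.factorial : ℝ) * (∑ p ∈ S, ‖a p‖ ^ 2) ^ k := by positivity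
  push_cast at hmvt hNT hNk' hlogN hlogN0 ⊢
  calc ∑ s ∈ 𝒮, ‖∑ n ∈ Finset.Icc 1 (N ^ k), powCoeff S a k n * (n : ℂ) ^ (-s)‖ ^ 2
      ≤ (5 * (T + 1 / 2) + 18 * (N : ℝ) ^ k) * (1⁻¹ + Real.log ((N : ℝ) ^ k)) * (1 + 2 * L * Real.log ((N : ℝ) ^ k)) *
          ∑ n ∈ Finset.Icc 1 (N ^ k), ‖powCoeff S a k n‖ ^ 2 := hmvt
    _ ≤ (5 * (T + 1 / 2) + 18 * T) * (1⁻¹ + Real.log T) * (1 + 2 * L * Real.log T) *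
          ((k.factorial : ℝ) * (∑ p ∈ S, ‖a p‖ ^ 2) ^ k) := by
        gcongr
    _ ≤ 26 * T * (1 + Real.log T) * (1 + 2 * L * Real.log T) * (k.factorial * (∑ p ∈ S, ‖a p‖ ^ 2) ^ k) := by
        rw [inv_one]
        have h1 : 5 * (T + 1 / 2) + 18 * T ≤ 26 * T := by linarith
        have h2 : 0 ≤ (1 + Real.log T) * (1 + 2 * L * Real.log T) * ((k.factorial : ℝ) * (∑ p ∈ S, ‖a p‖ ^ 2) ^ k) := by
          positivity
        nlinarith [h1, h2]

end Literature.NumberTheory.LFunctions
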